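import Literature.Barriers.ValiantsHypothesis.NotViaSaturations
import Mathlib.Tactic.NormNum.Prime
import HarnessLib

/-!
# The proved cases `n = p ± 1` of the Alon–Tarsi conjecture (Drisko 1997, Glynn 2010)
# and the unconditional instances of Kumar's stretching theorem they give

`NotViaSaturations.lean` records Kumar's theorem ([BurgisserHuttenhainIkenmeyer2017, Thm. 2]) as
the named fact `Kumar2015_stretching : ∀ m, Even m → AlonTarsiConjecture m → (nλ ∈ S(Det_n) for all
λ with ℓ(λ) ≤ n)`, conditional on the Alon–Tarsi conjecture `AlonTarsiConjecture m` (signed count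
of latin squares of size `m`, sign = product of the row and column permutation signs, `latinSign`).
The conjecture is a THEOREM for `m = p + 1` (Drisko) and `m = p - 1` (Glynn), `p` an odd prime; we
vendor these two published results as named facts (statements quoted verbatim below) and derive
the kernel-checked unconditional instances of Kumar's theorem in those dimensions — a sharpening
of the "no occurrence obstructions at stretching factor `n`" constraint for the GCT programme
(Bürgisser–Ikenmeyer–Panova, *No occurrence obstructions in GCT*, §1.2 "Related work: Kronecker
coefficients", arXiv:1604.06431 p. 3, ll. 470–474 of the source: "Kumar [Kum:15] ruled out asymptotic
considerations for the GCT-coefficients: assuming the Alon-Tarsi Conjecture [AT:92], he showed that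
K_n(nλ) > 0 for all λ ⊢ nd and even n" — `K_n(λ)` is BIP's GCT-coefficient, the multiplicity of
`λ ⊢ nd` in `ℂ[Ω_n]_d`, `Ω_n` the orbit closure of `det_n` (BIP ll. 260–262, 415–417); positivity `K_n(nλ) > 0` is the occurrence `nλ ∈ S(Det_n)`).

Sign conventions agree with the tree: Drisko (p. 20): "The sign of a row or column of a latin
square L is its sign as a permutation of the set {0, 1, ..., n−1}. The sign ε(L) of L is the
product of the 2n row and column signs. We shall call L even if ε(L) = +1 and odd if ε(L) = −1."
and his Conjecture 1 (Alon–Tarsi): "Let n be an even integer. Then Σ ε(L) ≠ 0, where the sum runs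
over all latin squares L of order n." — literally `AlonTarsiConjecture n`. Glynn (Def. 2.2, p. 397):
"par(L) ≡ rowpar(L) + colpar(L) (mod 2)", the row/column parities being "the signs of the
products of the permutations in the rows, columns … respectively" (§2).
-/

noncomputable section

namespace Literature.Barriers.ValiantsHypothesis

open Literature.NumberTheory.DiophantineGeometry Literature.Computability.Complexity

/-- **Drisko 1997** (Adv. Math. 128 (1997) 20–35). Abstract (p. 20), verbatim: "It is shown that
given an odd prime p, the number of even latin squares of order p+1 is not equal to the number
of odd latin squares of order p+1." Proved as Thm. 9 (p. 33): "Let p be an odd prime and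
n = p+1. Then the number of even latin squares of order n minus the number of odd latin squares
of order n is congruent modulo p³ to (−1)^{(p+1)/2} p²." (hence nonzero).
[cite: Drisko1997, abstract and Thm. 9] -/
def Drisko1997_AlonTarsi : Prop :=
  ∀ p : ℕ, p.Prime → Odd p → AlonTarsiConjecture (p + 1)

/-- **Glynn 2010** (SIAM J. Discrete Math. 24 (2010) 394–399). Abstract, verbatim: "It follows
that the number of even Latin squares of order p − 1 is not equal to the number of odd Latin
squares of that order." Proved as Thm. 3.2 (p. 398): "For any odd prime p, the number of even Latin
squares of order p − 1 minus the number of odd Latin squares of that order, is (−1)^{(p−1)/2}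
modulo p." (hence nonzero). [cite: Glynn2010AlonTarsi, abstract and Thm. 3.2] -/
def Glynn2010_AlonTarsi : Prop :=
  ∀ p : ℕ, p.Prime → Odd p → AlonTarsiConjecture (p - 1)

/-- **KERNEL — Kumar's stretching theorem is unconditional in dimension `p + 1`** (`p` an odd
prime): for every partition `λ` with at most `p + 1` parts, `(p+1)·λ ∈ S(Det_{p+1})`.
[cite: BurgisserHuttenhainIkenmeyer2017, Thm. 2 (Kumar)] [cite: Drisko1997, Thm. 9] -/
theorem kumar_stretching_prime_add_one (hK : Kumar2015_stretching) (hD : Drisko1997_AlonTarsi)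
    {p : ℕ} (hp : p.Prime) (hodd : Odd p) (D : ℕ) (lam : Nat.Partition D)
    (hlen : lam.parts.card ≤ p + 1) :
    (p + 1) • Weight.ofPartition ((p + 1) * (p + 1)) lam ∈ detOccWeights (p + 1) :=
  hK (p + 1) hodd.add_one (hD p hp hodd) D lam hlen

/-- **KERNEL — Kumar's stretching theorem is unconditional in dimension `p - 1`** (`p` an odd
prime): for every partition `λ` with at most `p - 1` parts, `(p-1)·λ ∈ S(Det_{p-1})`.
[cite: BurgisserHuttenhainIkenmeyer2017, Thm. 2 (Kumar)] [cite: Glynn2010AlonTarsi, Thm. 3.2] -/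
theorem kumar_stretching_prime_sub_one (hK : Kumar2015_stretching) (hG : Glynn2010_AlonTarsi)
    {p : ℕ} (hp : p.Prime) (hodd : Odd p) (D : ℕ) (lam : Nat.Partition D)
    (hlen : lam.parts.card ≤ p - 1) :
    (p - 1) • Weight.ofPartition ((p - 1) * (p - 1)) lam ∈ detOccWeights (p - 1) :=
  hK (p - 1) (Nat.Odd.sub_odd hodd odd_one) (hG p hp hodd) D lam hlen

/-- The even sizes below `26` are all of the form `p ± 1` (Glynn, Cor. 3.4, p. 399: "The smallest
unsolved case of even order for the Alon-Tarsi conjecture … is 26"): for even `m` with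
`2 ≤ m ≤ 24`, Kumar's theorem holds unconditionally given the two facts. KERNEL (finite check of
the twelve sizes). [cite: Glynn2010AlonTarsi, Cor. 3.4] -/
theorem alonTarsi_of_even_le_24 (hD : Drisko1997_AlonTarsi) (hG : Glynn2010_AlonTarsi)
    {m : ℕ} (hm : Even m) (h2 : 2 ≤ m) (h24 : m ≤ 24) : AlonTarsiConjecture m := by
  -- `m = 2k`, `k ∈ {1,…,12}`: 2=3-1, 4=3+1, 6=5+1, 8=7+1, 10=11-1, 12=11+1, 14=13+1,
  -- 16=17-1, 18=17+1, 20=19+1, 22=23-1, 24=23+1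
  obtain ⟨k, rfl⟩ := hm
  have hk1 : 1 ≤ k := by omega
  have hk12 : k ≤ 12 := by omega
  interval_cases k
  · exact hG 3 (by norm_num) (by decide)
  · exact hD 3 (by norm_num) (by decide)
  · exact hD 5 (by norm_num) (by decide)
  · exact hD 7 (by norm_num) (by decide)
  · exact hG 11 (by norm_num) (by decide)
  · exact hD 11 (by norm_num) (by decide)
  · exact hD 13 (by norm_num) (by decide)
  · exact hG 17 (by norm_num) (by decide)
  · exact hD 17 (by norm_num) (by decide)
  · exact hD 19 (by norm_num) (by decide)
  · exact hG 23 (by norm_num) (by decide)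
  · exact hD 23 (by norm_num) (by decide)

end Literature.Barriers.ValiantsHypothesis
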